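import Literature.Geometry.Lorentzian.KerrObstructionOuterLayer
import Literature.Geometry.Lorentzian.CoordMomentumPairingIntegral
import HarnessLib

/-!
# The linearised obstruction of Li–Mei's interior Kerr gluing as an explicit volume integral

Support file (all results proved; no named facts) for the named fact `LiMei.interiorKerrGluing`
(`InteriorKerrGluing.lean`; J. Li, H. Mei, *A construction of collapsing spacetimes in vacuum*,
Comm. Math. Phys. 378 (2020) = arXiv:2005.01249, Prop. 4.1), Step S5 of the architecture recorded
in `InteriorKerrGluingReduction.lean` (Li–Mei pp. 23–25: the projections `𝓘_α` of the constraint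
map onto the Killing initial data of the Schwarzschild cylinder, computed by an integration by
parts `(I_α)`).

Let `(G₀, K₀) = (cylH M 0 r₀ τ₀ R₀, cylK M 0 _ τ₀ R₀)` be the Schwarzschild cylinder
(`0 < r₀ < 2M`), `b` the standard basis of `E3`, and `χ = χ₀ ∘ ‖·‖` a smooth radial cut-off
vanishing on `‖y‖ ≤ s₁` (`s₁ > 1`) and on `s₂ ≤ ‖y‖`. For smooth symmetric variations `(γ, κ)` on
`{1 < ‖y‖}` the `L²(√g₀ dy)`-pairing of the LINEARISED momentum constraint
`DM_{(G₀,K₀)}(γ, κ)` with the cut-off Killing fields `χ ∂_t` (`∂_t = y/‖y‖`) and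
`χ Ω_ω` (`Ω_ω = ω × ·`) is the volume integral of the explicit integrands of
`KerrObstructionOuterLayer.lean`:

* `LiMei.integral_linMomFn_cutoff_dirVec_eq` —
  **`∫ √g₀ χ DM(γ, κ)(∂_t) dy = ∫ timeIntegrandWith M r₀ χ₀ (γ y) (κ y) y dy`**;
* `LiMei.integral_linMomFn_cutoff_crossCLM_eq` —
  **`∫ √g₀ χ DM(γ, κ)(Ω_ω) dy = ∫ rotIntegrandWith M r₀ χ₀ ω (γ y) (κ y) y dy`**

(Green's identity `IsMetricOn.integral_sqrtDetGram_mul_linMomFn_smul_eq` of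
`CoordMomentumPairingIntegral.lean`, the paired commutators of
`SchwarzschildCylinderCommutators.lean` on `{1 < ‖y‖}`, and the vanishing of both sides inside the
unit ball, where `χ ≡ 0`). Together with `KerrObstructionFirstOrder/OuterLayer/InnerLayer` this
makes Li–Mei's expansion `𝓘 = (8π δm, −8πM b⃗) + O(ε) + O(|p|²)` (p. 25) of the linear part of the
obstruction fully explicit.

The file also provides **the shell cut-off** `LiMei.shellProfile s₁ t₁ t₂ s₂ =
(1 − radialCutoff s₁ t₁) · radialCutoff t₂ s₂` on `ℝ` (smooth, `= 0` on `|r| ≤ s₁` and on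
`s₂ ≤ |r|`, `= 1` on `t₁ ≤ |r| ≤ t₂`; its radial version is smooth on `E3` with compact support in
`{1 < ‖y‖}`) and the pointwise splitting of its derivative into the inner and outer profiles
(`LiMei.deriv_shellProfile`), whence the splitting of both integrands
(`LiMei.timeIntegrandWith_shellProfile`, `LiMei.rotIntegrandWith_shellProfile`) into the
inner-layer part (`KerrObstructionInnerLayer`) and the outer-layer part (`KerrObstructionOuterLayer`).

## References

* J. Li, H. Mei, arXiv:2005.01249, §4, proof of Prop. 4.1, pp. 23–25 (key `LiMei2020`).
-/

noncomputable section

open Set Filter Function Metric MeasureTheory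
open scoped Topology RealInnerProductSpace Real ContDiff

namespace Literature.Geometry.Lorentzian

namespace LiMei

open MetricCoord

/-! ### The shell cut-off profile -/

/-- **The shell cut-off profile** `χ₀ = (1 − radialCutoff s₁ t₁) · radialCutoff t₂ s₂` on `ℝ`:
for `0 ≤ s₁ < t₁ ≤ t₂ < s₂` it vanishes on `|r| ≤ s₁` and on `s₂ ≤ |r|` and equals `1` on
`t₁ ≤ |r| ≤ t₂` (Li–Mei's `χ`, p. 24: a cut-off equal to `1` on the deformation shell with compact
support in the vacuum shell). [cite: LiMei2020, proof of Prop. 4.1, p. 24] -/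
def shellProfile (s₁ t₁ t₂ s₂ : ℝ) (r : ℝ) : ℝ :=
  (1 - radialCutoff s₁ t₁ r) * radialCutoff t₂ s₂ r

/-- The shell profile is smooth. [folklore] -/
theorem contDiff_shellProfile (s₁ t₁ t₂ s₂ : ℝ) : ContDiff ℝ ∞ (shellProfile s₁ t₁ t₂ s₂) :=
  (contDiff_const.sub (contDiff_radialCutoff s₁ t₁)).mul (contDiff_radialCutoff t₂ s₂)

/-- The shell profile is `C¹`. [folklore] -/
theorem contDiff_one_shellProfile (s₁ t₁ t₂ s₂ : ℝ) : ContDiff ℝ 1 (shellProfile s₁ t₁ t₂ s₂) :=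
  (contDiff_shellProfile s₁ t₁ t₂ s₂).of_le (by exact_mod_cast le_top)

/-- The radial shell cut-off `y ↦ χ₀(‖y‖)` is the product of the tree's radial cut-offs, hence
smooth on `E3`. [folklore] -/
theorem shellProfile_norm (s₁ t₁ t₂ s₂ : ℝ) (y : E3) :
    shellProfile s₁ t₁ t₂ s₂ ‖y‖ = (1 - radialCutoff s₁ t₁ y) * radialCutoff t₂ s₂ y := by
  rw [shellProfile, radialCutoff_eq_radialCutoff_norm, radialCutoff_eq_radialCutoff_norm]

/-- The radial shell cut-off is smooth on `E3`. [folklore] -/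
theorem contDiff_shellProfile_norm (s₁ t₁ t₂ s₂ : ℝ) :
    ContDiff ℝ ∞ fun y : E3 ↦ shellProfile s₁ t₁ t₂ s₂ ‖y‖ := by
  simp_rw [shellProfile_norm]
  exact (contDiff_const.sub (contDiff_radialCutoff s₁ t₁)).mul (contDiff_radialCutoff t₂ s₂)

/-- The shell profile vanishes on `|r| ≤ s₁`. [folklore] -/
theorem shellProfile_of_abs_le {s₁ t₁ t₂ s₂ : ℝ} (hs₁ : 0 ≤ s₁) (h₁ : s₁ < t₁) {r : ℝ}
    (hr : |r| ≤ s₁) : shellProfile s₁ t₁ t₂ s₂ r = 0 := by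
  rw [shellProfile, radialCutoff_real_of_abs_le hs₁ h₁ r hr, sub_self, zero_mul]

/-- The shell profile vanishes on `s₂ ≤ |r|`. [folklore] -/
theorem shellProfile_of_le_abs {s₁ t₁ t₂ s₂ : ℝ} (ht₂ : 0 ≤ t₂) (h₂ : t₂ < s₂) {r : ℝ}
    (hr : s₂ ≤ |r|) : shellProfile s₁ t₁ t₂ s₂ r = 0 := by
  rw [shellProfile, radialCutoff_real_of_le_abs ht₂ h₂ r hr, mul_zero]

/-- The shell profile equals `1` on `t₁ ≤ |r| ≤ t₂`. [folklore] -/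
theorem shellProfile_of_mem {s₁ t₁ t₂ s₂ : ℝ} (hs₁ : 0 ≤ s₁) (h₁ : s₁ < t₁) (h₁₂ : t₁ ≤ t₂)
    (h₂ : t₂ < s₂) {r : ℝ} (hr₁ : t₁ ≤ |r|) (hr₂ : |r| ≤ t₂) : shellProfile s₁ t₁ t₂ s₂ r = 1 := by
  rw [shellProfile, radialCutoff_real_of_le_abs hs₁ h₁ r hr₁,
    radialCutoff_real_of_abs_le (hs₁.trans (h₁.le.trans h₁₂)) h₂ r hr₂]
  ring

/-- **The derivative of the shell profile splits** into the derivatives of the inner profile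
`1 − radialCutoff s₁ t₁` and of the outer profile `radialCutoff t₂ s₂` (disjoint supports).
[folklore] -/
theorem deriv_shellProfile {s₁ t₁ t₂ s₂ : ℝ} (hs₁ : 0 ≤ s₁) (h₁ : s₁ < t₁) (h₁₂ : t₁ ≤ t₂)
    (h₂ : t₂ < s₂) (r : ℝ) :
    deriv (shellProfile s₁ t₁ t₂ s₂) r =
      deriv (fun x ↦ 1 - radialCutoff s₁ t₁ x) r + deriv (radialCutoff t₂ s₂) r := by
  have ht₂ : 0 ≤ t₂ := hs₁.trans (h₁.le.trans h₁₂)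
  have hd₁ : DifferentiableAt ℝ (fun x ↦ 1 - radialCutoff s₁ t₁ x) r :=
    ((contDiff_one_radialCutoff_real s₁ t₁).differentiable one_ne_zero r).const_sub 1
  have hd₂ : DifferentiableAt ℝ (radialCutoff t₂ s₂) r :=
    (contDiff_one_radialCutoff_real t₂ s₂).differentiable one_ne_zero r
  have hmul : shellProfile s₁ t₁ t₂ s₂ = fun x ↦ (1 - radialCutoff s₁ t₁ x) * radialCutoff t₂ s₂ x :=
    rfl
  rw [hmul, deriv_fun_mul hd₁ hd₂]
  -- case analysis on `|r|` relative to `t₁ ≤ t₂`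
  rcases le_or_gt (|r|) t₂ with hr | hr
  · -- here the outer profile is `1` near `r` unless `|r| = t₂`; use values and derivatives
    rcases lt_or_ge (|r|) t₁ with hr' | hr'
    · -- `|r| < t₁ ≤ t₂`: outer profile `≡ 1` near `r`, its derivative vanishes
      have h0 : deriv (radialCutoff t₂ s₂) r = 0 :=
        deriv_cutoffProfile_eq_zero_of_abs_lt (radialCutoff_real_of_abs_le ht₂ h₂)
          (lt_of_lt_of_le hr' h₁₂)
      rw [h0, radialCutoff_real_of_abs_le ht₂ h₂ r hr]
      ring
    · -- `t₁ ≤ |r| ≤ t₂`: inner profile `≡ 0`... i.e. `1 - radialCutoff s₁ t₁ ≡ 1` near... use values: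
      -- `radialCutoff s₁ t₁ r = 0`, `radialCutoff t₂ s₂ r = 1`, and the inner derivative vanishes
      -- unless `|r| = t₁`; in all cases the identity reduces by the values.
      rw [radialCutoff_real_of_le_abs hs₁ h₁ r hr', radialCutoff_real_of_abs_le ht₂ h₂ r hr]
      rcases eq_or_lt_of_le hr with heq | hlt
      · -- `|r| = t₂`: the outer derivative vanishes by continuity from the inside? use `t₁ < ...`:
        -- here `t₁ ≤ t₂ = |r|`; the inner derivative vanishes since `t₁ < |r|` or `t₁ = t₂ = |r|`.
        rcases eq_or_lt_of_le hr' with heq' | hlt'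
        · -- `t₁ = |r| = t₂`: both one-sided constant; derivative of outer at `|r| = t₂`:
          -- outer `= 1` on `|x| ≤ t₂`, so `deriv = 0` would need interior; instead compute directly:
          -- at such a point both profiles attain an extremum (`≤ 1`, `= 1`), so derivatives vanish.
          have hmax₂ : IsLocalMax (radialCutoff t₂ s₂) r := by
            filter_upwards with x
            rw [radialCutoff_real_of_abs_le ht₂ h₂ r hr]
            exact radialCutoff_le_one _ _ x
          have hmin₁ : IsLocalMin (radialCutoff s₁ t₁) r := by
            filter_upwards with x
            rw [radialCutoff_real_of_le_abs hs₁ h₁ r hr']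
            exact radialCutoff_nonneg _ _ x
          rw [hmax₂.deriv_eq_zero, deriv_const_sub, hmin₁.deriv_eq_zero]
          ring
        · have h0 : deriv (fun x ↦ 1 - radialCutoff s₁ t₁ x) r = 0 := by
            rw [deriv_const_sub, neg_eq_zero]
            exact deriv_cutoffProfile_eq_zero_of_lt_abs (radialCutoff_real_of_le_abs hs₁ h₁) hlt'
          have hmax₂ : IsLocalMax (radialCutoff t₂ s₂) r := by
            filter_upwards with x
            rw [radialCutoff_real_of_abs_le ht₂ h₂ r hr]
            exact radialCutoff_le_one _ _ x
          rw [h0, hmax₂.deriv_eq_zero]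
          ring
      · have h0 : deriv (radialCutoff t₂ s₂) r = 0 :=
          deriv_cutoffProfile_eq_zero_of_abs_lt (radialCutoff_real_of_abs_le ht₂ h₂) hlt
        rw [h0]
        ring
  · -- `t₂ < |r|`: inner profile `1 - radialCutoff s₁ t₁ ≡ 1` near `r`, its derivative vanishes
    have h0 : deriv (fun x ↦ 1 - radialCutoff s₁ t₁ x) r = 0 := by
      rw [deriv_const_sub, neg_eq_zero]
      exact deriv_cutoffProfile_eq_zero_of_lt_abs (radialCutoff_real_of_le_abs hs₁ h₁)
        (lt_of_le_of_lt h₁₂ hr)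
    rw [h0, radialCutoff_real_of_le_abs hs₁ h₁ r (h₁₂.trans hr.le)]
    ring

/-- **Splitting of the `∂_t`-integrand** along the shell profile into its inner and outer parts.
[folklore] -/
theorem timeIntegrandWith_shellProfile (M r₀ : ℝ) {s₁ t₁ t₂ s₂ : ℝ} (hs₁ : 0 ≤ s₁) (h₁ : s₁ < t₁)
    (h₁₂ : t₁ ≤ t₂) (h₂ : t₂ < s₂) (βH βK : E3 →L[ℝ] E3 →L[ℝ] ℝ) (y : E3) :
    timeIntegrandWith M r₀ (shellProfile s₁ t₁ t₂ s₂) βH βK y =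
      timeIntegrandWith M r₀ (fun x ↦ 1 - radialCutoff s₁ t₁ x) βH βK y +
        timeIntegrandWith M r₀ (radialCutoff t₂ s₂) βH βK y := by
  simp only [timeIntegrandWith, deriv_shellProfile hs₁ h₁ h₁₂ h₂]
  ring

/-- **Splitting of the `Ω_ω`-integrand** along the shell profile. [folklore] -/
theorem rotIntegrandWith_shellProfile (M r₀ : ℝ) {s₁ t₁ t₂ s₂ : ℝ} (hs₁ : 0 ≤ s₁) (h₁ : s₁ < t₁)
    (h₁₂ : t₁ ≤ t₂) (h₂ : t₂ < s₂) (ξ : E3) (βH βK : E3 →L[ℝ] E3 →L[ℝ] ℝ) (y : E3) :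
    rotIntegrandWith M r₀ (shellProfile s₁ t₁ t₂ s₂) ξ βH βK y =
      rotIntegrandWith M r₀ (fun x ↦ 1 - radialCutoff s₁ t₁ x) ξ βH βK y +
        rotIntegrandWith M r₀ (radialCutoff t₂ s₂) ξ βH βK y := by
  simp only [rotIntegrandWith, deriv_shellProfile hs₁ h₁ h₁₂ h₂]
  ring

/-- The inner profile has derivative supported in `s₁ ≤ |r| ≤ t₁` (hypothesis `hsupp` of
`KerrObstructionInnerLayer`). [folklore] -/
theorem deriv_inner_support {s₁ t₁ : ℝ} (hs₁ : 0 ≤ s₁) (h₁ : s₁ < t₁) (r : ℝ)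
    (h : deriv (fun x ↦ 1 - radialCutoff s₁ t₁ x) r ≠ 0) : s₁ ≤ |r| ∧ |r| ≤ t₁ := by
  rw [deriv_const_sub, neg_ne_zero] at h
  exact ⟨le_of_not_gt fun hlt ↦ h
      (deriv_cutoffProfile_eq_zero_of_abs_lt (radialCutoff_real_of_abs_le hs₁ h₁) hlt),
    le_of_not_gt fun hlt ↦ h
      (deriv_cutoffProfile_eq_zero_of_lt_abs (radialCutoff_real_of_le_abs hs₁ h₁) hlt)⟩

/-! ### Radial cut-offs vanishing inside a ball -/

/-- The derivative of a profile vanishing on `|r| ≤ s₁` vanishes on `|r| < s₁`. [folklore] -/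
theorem deriv_eq_zero_of_vanish_abs_lt {χ₀ : ℝ → ℝ} {s₁ : ℝ} (h0 : ∀ r, |r| ≤ s₁ → χ₀ r = 0)
    {r : ℝ} (hr : |r| < s₁) : deriv χ₀ r = 0 := by
  have h : χ₀ =ᶠ[𝓝 r] fun _ ↦ (0 : ℝ) :=
    Filter.eventually_of_mem ((isOpen_lt continuous_abs continuous_const).mem_nhds hr)
      fun x hx ↦ h0 x (le_of_lt hx)
  rw [h.deriv_eq, deriv_const]

/-- A radial cut-off vanishing on `‖y‖ ≤ s₁` kills every field near a point with `‖y‖ < s₁`.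
[folklore] -/
theorem cutoff_smul_eventuallyEq_zero {χ₀ : ℝ → ℝ} {s₁ : ℝ} (h0 : ∀ r, |r| ≤ s₁ → χ₀ r = 0)
    (X : E3 → E3) {y : E3} (hy : ‖y‖ < s₁) :
    (fun z : E3 ↦ χ₀ ‖z‖ • X z) =ᶠ[𝓝 y] fun _ ↦ 0 := by
  filter_upwards [(isOpen_lt continuous_norm continuous_const).mem_nhds hy] with z hz
  rw [h0 ‖z‖ (by rw [abs_norm]; exact le_of_lt hz), zero_smul]

/-- A radial cut-off vanishing on `s₂ ≤ ‖y‖` has compact support. [folklore] -/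
theorem hasCompactSupport_cutoff {χ₀ : ℝ → ℝ} {s₂ : ℝ} (h0 : ∀ r, s₂ ≤ |r| → χ₀ r = 0) :
    HasCompactSupport fun y : E3 ↦ χ₀ ‖y‖ := by
  refine HasCompactSupport.intro (K := closedBall (0 : E3) |s₂|) (isCompact_closedBall _ _)
    fun y hy ↦ ?_
  rw [mem_closedBall, dist_zero_right, not_le] at hy
  exact h0 ‖y‖ (by rw [abs_norm]; exact (le_abs_self _).trans hy.le)

/-- A radial cut-off vanishing on `‖y‖ ≤ s₁` with `1 < s₁` has topological support inside
`{1 < ‖y‖}`. [folklore] -/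
theorem tsupport_cutoff_subset {χ₀ : ℝ → ℝ} {s₁ : ℝ} (hs₁ : 1 < s₁)
    (h0 : ∀ r, |r| ≤ s₁ → χ₀ r = 0) : tsupport (fun y : E3 ↦ χ₀ ‖y‖) ⊆ {y : E3 | 1 < ‖y‖} := by
  have hsub : support (fun y : E3 ↦ χ₀ ‖y‖) ⊆ {y : E3 | s₁ ≤ ‖y‖} := by
    intro y hy
    by_contra hlt
    simp only [mem_setOf_eq, not_le] at hlt
    exact hy (h0 ‖y‖ (by rw [abs_norm]; exact hlt.le))
  intro y hy
  have h := closure_minimal hsub (isClosed_le continuous_const continuous_norm) hy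
  exact lt_of_lt_of_le hs₁ h

/-- `⟨α, 0⟩_G = 0`. [folklore] -/
theorem pairAt_zero_arg (G : E3 → E3 →L[ℝ] E3 →L[ℝ] ℝ) (x : E3) (α : E3 →L[ℝ] E3 →L[ℝ] ℝ) :
    pairAt G x α 0 = 0 := by
  simp [pairAt]

/-! ### The linearised obstruction as a volume integral -/

section Linearised

variable [Kerr.Facts] {M r₀ : ℝ}

/-- Positivity of the Schwarzschild cylinder metric. [cite: LiMei2020, (4.1)] -/
theorem cylH_zero_spin_pos (hr₀ : 0 < r₀) (h2M : r₀ < 2 * M) (τ₀ : ℝ) (R : E3 →ₗᵢ[ℝ] E3) (y : E3)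
    {v : E3} (hv : v ≠ 0) : 0 < cylH M 0 r₀ τ₀ R y v v := by
  obtain ⟨ha, h₁, h₂⟩ := admissible_zero_spin hr₀ h2M
  exact cylH_pos ha h₁ h₂ τ₀ R y hv

/-- **`∫ √g₀ χ DM(γ,κ)(∂_t) dy = ∫ timeIntegrandWith M r₀ χ₀ (γ y) (κ y) y dy`.** The
`L²(√g₀ dy)`-pairing of the linearised momentum constraint at the Schwarzschild cylinder with the
cut-off Killing field `χ ∂_t` (`χ = χ₀ ∘ ‖·‖` smooth and radial, vanishing on `‖y‖ ≤ s₁`,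
`s₁ > 1`, and on `s₂ ≤ ‖y‖`) is the volume integral of the explicit `∂_t`-integrand, for all smooth
symmetric variations `(γ, κ)` on `{1 < ‖y‖}` (Li–Mei's `(I_0)` after integration by parts, with
the boundary terms replaced by the cut-off). [cite: LiMei2020, proof of Prop. 4.1, pp. 23–25] -/
theorem integral_linMomFn_cutoff_dirVec_eq (hr₀ : 0 < r₀) (h2M : r₀ < 2 * M) (τ₀ : ℝ)
    (R₀ : E3 →ₗᵢ[ℝ] E3) {χ₀ : ℝ → ℝ} {s₁ s₂ : ℝ} (hs₁ : 1 < s₁)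
    (hχE : ContDiff ℝ ∞ fun y : E3 ↦ χ₀ ‖y‖) (hχ : ContDiff ℝ 1 χ₀)
    (h0in : ∀ r, |r| ≤ s₁ → χ₀ r = 0) (h0out : ∀ r, s₂ ≤ |r| → χ₀ r = 0)
    {γ κ : E3 → E3 →L[ℝ] E3 →L[ℝ] ℝ} (hγ : ContDiffOn ℝ ∞ γ {y : E3 | 1 < ‖y‖})
    (hγs : ∀ y ∈ {y : E3 | 1 < ‖y‖}, ∀ v w, γ y v w = γ y w v)
    (hκ : ContDiffOn ℝ ∞ κ {y : E3 | 1 < ‖y‖})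
    (hκs : ∀ y ∈ {y : E3 | 1 < ‖y‖}, ∀ v w, κ y v w = κ y w v) :
    ∫ y, sqrtDetGram (cylH M 0 r₀ τ₀ R₀) (EuclideanSpace.basisFun (Fin 3) ℝ).toBasis y *
        (χ₀ ‖y‖ * linMomFn (EuclideanSpace.basisFun (Fin 3) ℝ).toBasis (cylH M 0 r₀ τ₀ R₀)
          (cylK M 0 hr₀ τ₀ R₀) γ κ y (dirVec y)) =
      ∫ y, timeIntegrandWith M r₀ χ₀ (γ y) (κ y) y := by
  classical
  have hG := isMetricOn_cylH_zero_spin hr₀ h2M τ₀ R₀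
  have hibp := hG.integral_sqrtDetGram_mul_linMomFn_smul_eq
    (EuclideanSpace.basisFun (Fin 3) ℝ).toBasis volume
    (fun y _ v hv ↦ cylH_zero_spin_pos hr₀ h2M τ₀ R₀ y hv)
    (contDiff_cylK_zero_spin hr₀ h2M τ₀ R₀).contDiffOn
    (fun y _ v w ↦ cylK_zero_spin_symm hr₀ h2M τ₀ R₀ y v w) hγ hγs hκ hκs
    (X := dirVec) contDiffOn_dirVec hχE (hasCompactSupport_cutoff h0out)
    (tsupport_cutoff_subset hs₁ h0in)
  rw [hibp]
  refine integral_congr_ae (ae_of_all _ fun y ↦ ?_)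
  show sqrtDetGram (cylH M 0 r₀ τ₀ R₀) (EuclideanSpace.basisFun (Fin 3) ℝ).toBasis y *
      (pairAt (cylH M 0 r₀ τ₀ R₀) y (γ y)
          (adjMomGS (cylH M 0 r₀ τ₀ R₀) (cylK M 0 hr₀ τ₀ R₀) (fun z ↦ χ₀ ‖z‖ • dirVec z) y) +
        pairAt (cylH M 0 r₀ τ₀ R₀) y (κ y)
          (adjMomKS (cylH M 0 r₀ τ₀ R₀) (fun z ↦ χ₀ ‖z‖ • dirVec z) y)) =
    timeIntegrandWith M r₀ χ₀ (γ y) (κ y) y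
  by_cases hy : 1 < ‖y‖
  · have hd : DifferentiableAt ℝ χ₀ ‖y‖ := hχ.differentiable one_ne_zero _
    rw [pairAt_adjMomGS_cutoff_dirVec hr₀ h2M τ₀ R₀ hy hd (hγs y hy),
      pairAt_adjMomKS_cutoff_dirVec hr₀ h2M τ₀ R₀ hy hd (hκs y hy),
      sqrtDetGram_cylH_zero_spin hr₀ h2M τ₀ R₀ hy, timeIntegrandWith]
  · have hy' : ‖y‖ < s₁ := lt_of_le_of_lt (not_lt.1 hy) hs₁
    have hz := cutoff_smul_eventuallyEq_zero h0in dirVec hy'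
    rw [adjMomGS_eq_zero_of_eventuallyEq hz, adjMomKS_eq_zero_of_eventuallyEq hz, pairAt_zero_arg,
      pairAt_zero_arg, add_zero, mul_zero, timeIntegrandWith_eq_zero M r₀ _ _
        (deriv_eq_zero_of_vanish_abs_lt h0in (by rwa [abs_norm]))]

/-- **`∫ √g₀ χ DM(γ,κ)(Ω_ω) dy = ∫ rotIntegrandWith M r₀ χ₀ ω (γ y) (κ y) y dy`** for the cut-off
rotation `χ Ω_ω`, `Ω_ω = ω × ·` (Li–Mei's `(I_i)`, `i = 1, 2, 3`).
[cite: LiMei2020, proof of Prop. 4.1, pp. 23–25] -/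
theorem integral_linMomFn_cutoff_crossCLM_eq (hr₀ : 0 < r₀) (h2M : r₀ < 2 * M) (τ₀ : ℝ)
    (R₀ : E3 →ₗᵢ[ℝ] E3) (ξ : E3) {χ₀ : ℝ → ℝ} {s₁ s₂ : ℝ} (hs₁ : 1 < s₁)
    (hχE : ContDiff ℝ ∞ fun y : E3 ↦ χ₀ ‖y‖) (hχ : ContDiff ℝ 1 χ₀)
    (h0in : ∀ r, |r| ≤ s₁ → χ₀ r = 0) (h0out : ∀ r, s₂ ≤ |r| → χ₀ r = 0)
    {γ κ : E3 → E3 →L[ℝ] E3 →L[ℝ] ℝ} (hγ : ContDiffOn ℝ ∞ γ {y : E3 | 1 < ‖y‖})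
    (hγs : ∀ y ∈ {y : E3 | 1 < ‖y‖}, ∀ v w, γ y v w = γ y w v)
    (hκ : ContDiffOn ℝ ∞ κ {y : E3 | 1 < ‖y‖})
    (hκs : ∀ y ∈ {y : E3 | 1 < ‖y‖}, ∀ v w, κ y v w = κ y w v) :
    ∫ y, sqrtDetGram (cylH M 0 r₀ τ₀ R₀) (EuclideanSpace.basisFun (Fin 3) ℝ).toBasis y *
        (χ₀ ‖y‖ * linMomFn (EuclideanSpace.basisFun (Fin 3) ℝ).toBasis (cylH M 0 r₀ τ₀ R₀)
          (cylK M 0 hr₀ τ₀ R₀) γ κ y (crossCLM ξ y)) =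
      ∫ y, rotIntegrandWith M r₀ χ₀ ξ (γ y) (κ y) y := by
  classical
  have hG := isMetricOn_cylH_zero_spin hr₀ h2M τ₀ R₀
  have hibp := hG.integral_sqrtDetGram_mul_linMomFn_smul_eq
    (EuclideanSpace.basisFun (Fin 3) ℝ).toBasis volume
    (fun y _ v hv ↦ cylH_zero_spin_pos hr₀ h2M τ₀ R₀ y hv)
    (contDiff_cylK_zero_spin hr₀ h2M τ₀ R₀).contDiffOn
    (fun y _ v w ↦ cylK_zero_spin_symm hr₀ h2M τ₀ R₀ y v w) hγ hγs hκ hκs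
    (X := fun y ↦ crossCLM ξ y) (crossCLM ξ).contDiff.contDiffOn hχE
    (hasCompactSupport_cutoff h0out) (tsupport_cutoff_subset hs₁ h0in)
  rw [hibp]
  refine integral_congr_ae (ae_of_all _ fun y ↦ ?_)
  show sqrtDetGram (cylH M 0 r₀ τ₀ R₀) (EuclideanSpace.basisFun (Fin 3) ℝ).toBasis y *
      (pairAt (cylH M 0 r₀ τ₀ R₀) y (γ y)
          (adjMomGS (cylH M 0 r₀ τ₀ R₀) (cylK M 0 hr₀ τ₀ R₀) (fun z ↦ χ₀ ‖z‖ • crossCLM ξ z) y) +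
        pairAt (cylH M 0 r₀ τ₀ R₀) y (κ y)
          (adjMomKS (cylH M 0 r₀ τ₀ R₀) (fun z ↦ χ₀ ‖z‖ • crossCLM ξ z) y)) =
    rotIntegrandWith M r₀ χ₀ ξ (γ y) (κ y) y
  by_cases hy : 1 < ‖y‖
  · have hd : DifferentiableAt ℝ χ₀ ‖y‖ := hχ.differentiable one_ne_zero _
    rw [pairAt_adjMomGS_cutoff_skew hr₀ h2M τ₀ R₀ (crossCLM ξ) (inner_crossCLM_skew ξ) hy hd
        (hγs y hy),
      pairAt_adjMomKS_cutoff_skew hr₀ h2M τ₀ R₀ (crossCLM ξ) (inner_crossCLM_skew ξ) hy hd (hκs y hy),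
      sqrtDetGram_cylH_zero_spin hr₀ h2M τ₀ R₀ hy, rotIntegrandWith]
  · have hy' : ‖y‖ < s₁ := lt_of_le_of_lt (not_lt.1 hy) hs₁
    have hz := cutoff_smul_eventuallyEq_zero h0in (fun z ↦ crossCLM ξ z) hy'
    rw [adjMomGS_eq_zero_of_eventuallyEq hz, adjMomKS_eq_zero_of_eventuallyEq hz, pairAt_zero_arg,
      pairAt_zero_arg, add_zero, mul_zero, rotIntegrandWith_eq_zero M r₀ ξ _ _
        (deriv_eq_zero_of_vanish_abs_lt h0in (by rwa [abs_norm]))]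

omit [Kerr.Facts] in
/-- The shell cut-off satisfies the hypotheses of the two identities above (`1 < s₁ < t₁ ≤ t₂ < s₂`).
[folklore] -/
theorem shellProfile_hypotheses {s₁ t₁ t₂ s₂ : ℝ} (hs₁ : 1 < s₁) (h₁ : s₁ < t₁) (h₁₂ : t₁ ≤ t₂)
    (h₂ : t₂ < s₂) :
    (ContDiff ℝ ∞ fun y : E3 ↦ shellProfile s₁ t₁ t₂ s₂ ‖y‖) ∧
      ContDiff ℝ 1 (shellProfile s₁ t₁ t₂ s₂) ∧
      (∀ r, |r| ≤ s₁ → shellProfile s₁ t₁ t₂ s₂ r = 0) ∧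
      (∀ r, s₂ ≤ |r| → shellProfile s₁ t₁ t₂ s₂ r = 0) :=
  have hs₀ : 0 ≤ s₁ := zero_le_one.trans hs₁.le
  ⟨contDiff_shellProfile_norm s₁ t₁ t₂ s₂, contDiff_one_shellProfile s₁ t₁ t₂ s₂,
    fun _ hr ↦ shellProfile_of_abs_le hs₀ h₁ hr,
    fun _ hr ↦ shellProfile_of_le_abs (hs₀.trans (h₁.le.trans h₁₂)) h₂ hr⟩

end Linearised

end LiMei

end Literature.Geometry.Lorentzian

end
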